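import Summits.QuantumFields.YangMills.Theorems.BalabanUVNodesN15BackgroundV1CoarseNode
import Summits.QuantumFields.YangMills.Theorems.BalabanUVNodesN15VectorPieceV1Gauge
import Summits.QuantumFields.YangMills.Theorems.BalabanUVNodesN15TwoGridTransports
import HarnessLib

/-!
# Route «BalabanUVNodes» (K4 «SpineRates»), node N15 = NE2 — THE KNIT WITH THE PAIRING-CONSISTENT COARSE `V′₁`: King's bond pairing satisfies the
# BLOCK-TRANSLATION LAW `prV∘(shift′_μ)^{L^m} = shift_μ∘prV` (L^m fine steps are one coarse step), hence `T4EtaRate.NE2PlusOperator` BY NAME for the U = 1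
# vector piece ⊗ 1_𝔤 dressed by `V′₁(A)` with the gauge field `A′` the datum AND THE COARSE COEFFICIENTS AT `(Ā, Ā∘s⁻¹, ∇*Ā)`, `Ā` the block mean of `A′`

Cell `pub-ymgap`, seat `pub-ymgap-dag-n15-c` (generation g4; R134 ACCELERATION SEAT, strategy s1; HUMAN RULING D-0062; chair R424 venue; `bears_on: R4∕N15`).
Filed `--supports stmt-QuantumFields-19912 --as helper` (K3‴ `SpineGivenEndpointR13`; KEY TABLE WORDS-133; helper, count-neutral).  Imports BY NAME, nothing in the
tree modified: this seat's `…N15BackgroundV1CoarseNode` (**`ne2PlusOperator_v1GC`**, `v1GCFamily4`), g3 `…N15VectorPieceV1Gauge` (`fibre_conn_kingPrV`,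
`bshiftEquiv_comm`; through it `v1GVecInstance`, `bshiftEquiv`, `uniform_layer_v1M`), n15-a part 34 `…N15TwoGridTransports` (`TwoGrid.kingPr_add_smul_unitVec`:
`pr(z + L^m e′_κ) = pr z + e_κ`).

CONTENTS (namespace `…N15.VectorPiece`).  `bshiftEquiv_pow_apply` (`(shift_κ)^N (x, a) = (x + N•e_κ, a)`), **`kingPrV_bshiftEquiv_pow`** (the block-translation
law for King's bond pairing, `N = L^m`), `v1GCVecFamily4` (def: `v1GCFamily4` fed with the -a pieces ⊗ 1_𝔤, same data as g3's `v1GVecFamily4`),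
★ **`ne2PlusOperator_vectorPiece_v1GC`** (`NE2PlusOperator c₃₅ (v1GVecInstance 𝔄 ι L hL) (v1GCVecFamily4 𝔄 ι e L hL)`, `d ≥ 1`, `L ≥ 1`, every `c₃₅ > 0`), `_dim4`,
`ne2ZeroOperator_vectorPiece_v1GC` (+`_dim4`).

HONEST FRAMING ∕ LIMITS.  A knit plus one lattice-geometric lemma; C² letters = OUR unit-scale reading of (3.35)–(3.36); transport = fibrewise mean (linearised
(C3)) — NOW with the coarse `V′₁` triple THE DERIVED TRIPLE OF THE TRANSPORTED FIELD (g3's «coarse triple = mean of the fine triple» caveat REMOVED); `V′₂`,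
`F′_{1,k}` not in this family (the words files `…VWords…` carry them); LINEAR (U = 1) vector piece; NOT NODE 00's carriers.  NE2⁺ NOT PRINTED; count-neutral (typed
28∕28 · discharged unchanged); NOT a discharge of N15; one finite T⁴ at fixed ε — NOT infinite volume, NOT OS on ℝ⁴, NOT a mass gap, NOT Clay.
-/

noncomputable section

open scoped BigOperators
open Finset

namespace Summit.QuantumFields.YangMills.BalabanUVNodes.N15.VectorPiece

open Literature.MathematicalPhysics.QuantumFieldTheory.Balaban1983to89
open Literature.MathematicalPhysics.QuantumFieldTheory.Balaban1983to89.B11SectG (BlockNorm HasMaj RowSum)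
open Literature.MathematicalPhysics.QuantumFieldTheory.Balaban1983to89.B6RandomWalk (Triangle254)
open Literature.MathematicalPhysics.QuantumFieldTheory.Balaban1983to89.T4EtaRate (PairedInstance NE2PlusOperator NE2ZeroOperator ne2Zero_of_ne2Plus)
open Literature.MathematicalPhysics.QuantumFieldTheory.Balaban1983to89.T4EtaRateDefect (idef rateWeight)
open Literature.MathematicalPhysics.QuantumFieldTheory.Balaban1983to89.T4EtaRateCoeffDefect (pull)
open Literature.MathematicalPhysics.QuantumFieldTheory.Balaban1983to89.B5Prop11Plancherel (Tor fine unitVec)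
open Literature.MathematicalPhysics.QuantumFieldTheory.Balaban1983to89.B6UnitTorusCarrier (unitTorusGeo unitTorusGeo_len triangle254_unitTorusGeo
  rowSum_unitTorusGeo)
open Literature.MathematicalPhysics.QuantumFieldTheory.King1986.Torus (tdistT tdistT_nonneg)
open Summit.QuantumFields.YangMills.BalabanUVNodes.N15.MatrixSpecies (liftMap liftBlk)
open Summit.QuantumFields.YangMills.BalabanUVNodes.N15.BackgroundLayer (ne2PlusOperator_v1GC v1GCFamily4)
open Summit.QuantumFields.YangMills.BalabanUVNodes.N15.TwoGrid (kingPr_add_smul_unitVec)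

variable {d : ℕ}

/-! ## §1 The block-translation law of King's bond pairing -/

section Law

variable (L k m : ℕ) [NeZero L] (M : Fin (d + 1) → ℕ) [∀ μ, NeZero (M μ)]

omit [NeZero L] [∀ μ, NeZero (M μ)] in
/-- Powers of the bond shift: `(shift_κ)^N (x, a) = (x + N•e_κ, a)`. [folklore] -/
theorem bshiftEquiv_pow_apply (n : ℕ) (κ : Fin (d + 1)) :
    ∀ (N : ℕ) (i : Tor (fine n M) × Fin (d + 1)), (bshiftEquiv M n κ ^ N) i = (i.1 + N • unitVec (fine n M) κ, i.2) := by
  intro N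
  induction N with
  | zero => intro i; simp
  | succ N ih =>
      intro i
      rw [pow_succ, Equiv.Perm.mul_apply, ih, bshiftEquiv_apply]
      refine Prod.ext ?_ rfl
      show i.1 + unitVec (fine n M) κ + N • unitVec (fine n M) κ = i.1 + (N + 1) • unitVec (fine n M) κ
      rw [succ_nsmul', add_assoc]

/-- **THE BLOCK-TRANSLATION LAW OF KING's BOND PAIRING**: `L^m` fine bond shifts in direction `κ` followed by the pairing = the pairing followed by ONE coarse
bond shift — `prV((shift′_κ)^{L^m}(x′, a)) = shift_κ(prV(x′, a))` (n15-a's `pr(z + L^m e′_κ) = pr z + e_κ` on the base point). [cite: King1986, p.664 (pairing convention «x′ ∈ B^n(x)»)] -/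
theorem kingPrV_bshiftEquiv_pow (κ : Fin (d + 1)) (i : Tor (fine (L ^ m * L ^ k) M) × Fin (d + 1)) :
    kingPrV L k m M ((bshiftEquiv M (L ^ m * L ^ k) κ ^ (L ^ m)) i) = bshiftEquiv M (L ^ k) κ (kingPrV L k m M i) := by
  rw [bshiftEquiv_pow_apply, kingPrV_eq, kingPrV_eq, bshiftEquiv_apply]
  exact Prod.ext (kingPr_add_smul_unitVec M L k m i.1 κ) rfl

end Law

/-! ## §2 The realised family with the pairing-consistent coarse side; the knit -/

section Knit

variable (𝔄 : Type) [NormedRing 𝔄] [NormedAlgebra ℝ 𝔄] [CompleteSpace 𝔄] (ι : Type) [Fintype ι] [DecidableEq ι] (e : 𝔄 ≃L[ℝ] (ι → ℝ)) (L : ℕ) [NeZero L]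

/-- THE REALISED GAUGE KERNEL FAMILY WITH THE COARSE `V′₁` AT THE MEAN FIELD's TRIPLE: `v1GCFamily4` fed with the -a pieces ⊗ 1_𝔤 — exactly the data of
g3's `v1GVecFamily4` (pieces `G`, `G∂_ν*`, `(Δ−∂∂*)G`, `dPieces`, `mPieces` at both spacings; entry-1 direction `inl j.ν`). [cite: Balaban1985BackgroundPropagators, (3.42) p.397, (3.44) p.398, (3.52) p.400, (3.63)–(3.65) pp.402–403 (shapes, mechanism)] -/
def v1GCVecFamily4 (hL : 1 ≤ L) (j : VecIndexS d L) :
    B9.KernelFamily (v1GVecInstance (d := d) 𝔄 ι L hL j).gc (v1GVecInstance (d := d) 𝔄 ι L hL j).Bf :=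
  v1GCFamily4 e (g := unitTorusGeoS L j.k j.Mn j.Msz) (blkFine L j.k j.Mn) (kingPrV L j.k j.m j.Mn) (bshiftEquiv j.Mn (L ^ j.k))
    (bshiftEquiv j.Mn (L ^ j.m * L ^ j.k)) j.m (unitTorusGeoS_L_ne_zero L hL j) (Sum.inl j.ν)
    (tensorId ι (pieceG L j.Mn (L ^ j.k) j.k (rweight (d := d) L j.k))) (tensorId ι (pieceS L j.Mn (L ^ j.k) j.k (rweight (d := d) L j.k) j.ν))
    (tensorId ι (pieceD3 L j.Mn (L ^ j.k) j.k (rweight (d := d) L j.k)))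
    (fun μ => tensorId ι (dPieces L j.Mn (L ^ j.k) j.k (rweight (d := d) L j.k) μ))
    (fun μ => tensorId ι (mPieces L j.Mn (L ^ j.k) j.k (rweight (d := d) L j.k) j.ν μ))
    (tensorId ι (pieceG L j.Mn (L ^ j.m * L ^ j.k) (j.k + j.m) (rweight (d := d) L j.k / ((L : ℝ) ^ j.m) ^ (d + 1))))
    (tensorId ι (pieceS L j.Mn (L ^ j.m * L ^ j.k) (j.k + j.m) (rweight (d := d) L j.k / ((L : ℝ) ^ j.m) ^ (d + 1)) j.ν))
    (tensorId ι (pieceD3 L j.Mn (L ^ j.m * L ^ j.k) (j.k + j.m) (rweight (d := d) L j.k / ((L : ℝ) ^ j.m) ^ (d + 1))))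
    (fun μ => tensorId ι (dPieces L j.Mn (L ^ j.m * L ^ j.k) (j.k + j.m) (rweight (d := d) L j.k / ((L : ℝ) ^ j.m) ^ (d + 1)) μ))
    (fun μ => tensorId ι (mPieces L j.Mn (L ^ j.m * L ^ j.k) (j.k + j.m) (rweight (d := d) L j.k / ((L : ℝ) ^ j.m) ^ (d + 1)) j.ν μ))

variable {𝔄 ι L}

/-- **NE2⁺, OPERATOR LAYER — `T4EtaRate.NE2PlusOperator` BY NAME FOR THE U = 1 VECTOR SINGLE-SCALE PIECE ⊗ 1_𝔤 DRESSED BY `V′₁(A)`, GAUGE FIELD `A′` THE DATUM,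
COARSE COEFFICIENTS AT THE DERIVED TRIPLE OF THE BLOCK MEAN `Ā`** (the pairing-consistent coarse side): g3's `ne2PlusOperator_vectorPiece_v1G` with the family
`v1GCVecFamily4`; the one new input is the block-translation law `kingPrV_bshiftEquiv_pow` (`N = L^m`, `η = L^m η′`); all U ≡ 1 inputs from `uniform_layer_v1M`,
step-connectivity `C_π = 2(d+1)(L^m − 1)` from `fibre_conn_kingPrV`. [cite: Balaban1985BackgroundPropagators, Thm 3.1 p.397 (quantifier template), (3.35)–(3.36) p.396, (3.42) p.397, (3.44) p.398, (3.50)–(3.52) p.400, (3.63)–(3.65) pp.402–403 (shapes, mechanism); King1986, (4.42)–(4.43) p.675, p.664] -/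
theorem ne2PlusOperator_vectorPiece_v1GC (hd : 1 ≤ d) (hL : 1 ≤ L) (c35 : ℝ) (hc35 : 0 < c35) :
    NE2PlusOperator c35 (v1GVecInstance (d := d) 𝔄 ι L hL) (v1GCVecFamily4 (d := d) 𝔄 ι e L hL) := by
  obtain ⟨β, δ, m₀, hβ, hδ, hm₀, H⟩ := uniform_layer_v1M (d := d) (ι := ι) (L := L) hd hL
  have hL0 : L ≠ 0 := by omega
  have hLr : (0 : ℝ) < (L : ℝ) := by exact_mod_cast (show 0 < L by omega)
  have hL1 : (1 : ℝ) ≤ (L : ℝ) := by exact_mod_cast hL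
  have hσ : 0 < δ / 2 := half_pos hδ
  have hd1 : (0 : ℝ) ≤ 2 * ((d : ℝ) + 1) := by positivity
  -- `C_π(j)·η′_j = 2(d+1)(L^m − 1)·L^{−k}L^{−m} ≤ 2(d+1)·L^{−k} ≤ 2(d+1)·θ_j`
  have hCθ : ∀ j : VecIndexS d L, ((2 * ((d + 1) * (L ^ j.m - 1)) : ℕ) : ℝ) *
      ((unitTorusGeoS L j.k j.Mn j.Msz).eta * ((unitTorusGeoS L j.k j.Mn j.Msz).L ^ j.m)⁻¹) ≤ 2 * ((d : ℝ) + 1) * thetaV L j := by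
    intro j
    have hLm : (0 : ℝ) < (L : ℝ) ^ j.m := pow_pos hLr _
    have hLk : (0 : ℝ) < (L : ℝ) ^ j.k := pow_pos hLr _
    have hθ : ((L : ℝ) ^ j.k)⁻¹ ≤ thetaV L j := inv_pow_le_rpow hL j.k (by norm_num)
    have hsub : (((L ^ j.m - 1 : ℕ)) : ℝ) ≤ (L : ℝ) ^ j.m := by
      have h1 : 1 ≤ L ^ j.m := Nat.one_le_pow _ _ (by omega)
      rw [Nat.cast_sub h1]; push_cast; linarith
    show ((2 * ((d + 1) * (L ^ j.m - 1)) : ℕ) : ℝ) * (((L : ℝ) ^ j.k)⁻¹ * ((L : ℝ) ^ j.m)⁻¹) ≤ 2 * ((d : ℝ) + 1) * thetaV L j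
    have hcast : ((2 * ((d + 1) * (L ^ j.m - 1)) : ℕ) : ℝ) = 2 * ((d : ℝ) + 1) * (((L ^ j.m - 1 : ℕ)) : ℝ) := by push_cast; ring
    rw [hcast]
    calc 2 * ((d : ℝ) + 1) * (((L ^ j.m - 1 : ℕ)) : ℝ) * (((L : ℝ) ^ j.k)⁻¹ * ((L : ℝ) ^ j.m)⁻¹)
        ≤ 2 * ((d : ℝ) + 1) * (L : ℝ) ^ j.m * (((L : ℝ) ^ j.k)⁻¹ * ((L : ℝ) ^ j.m)⁻¹) :=
          mul_le_mul_of_nonneg_right (mul_le_mul_of_nonneg_left hsub hd1) (by positivity)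
      _ = 2 * ((d : ℝ) + 1) * ((L : ℝ) ^ j.k)⁻¹ := by field_simp
      _ ≤ 2 * ((d : ℝ) + 1) * thetaV L j := mul_le_mul_of_nonneg_left hθ hd1
  -- the block-translation law of King's pairing (`N = L^m`) and `η = L^m·η′`
  have hblk : ∀ (j : VecIndexS d L) (μ : Fin (d + 1)) (x' : Tor (fine (L ^ j.m * L ^ j.k) j.Mn) × Fin (d + 1)),
      kingPrV L j.k j.m j.Mn ((bshiftEquiv j.Mn (L ^ j.m * L ^ j.k) μ ^ (L ^ j.m)) x') =
        bshiftEquiv j.Mn (L ^ j.k) μ (kingPrV L j.k j.m j.Mn x') := fun j μ x' => kingPrV_bshiftEquiv_pow L j.k j.m j.Mn μ x'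
  have hN : ∀ j : VecIndexS d L, (unitTorusGeoS L j.k j.Mn j.Msz).eta =
      ((L ^ j.m : ℕ) : ℝ) * ((unitTorusGeoS L j.k j.Mn j.Msz).eta * ((unitTorusGeoS L j.k j.Mn j.Msz).L ^ j.m)⁻¹) := by
    intro j
    show ((L : ℝ) ^ j.k)⁻¹ = ((L ^ j.m : ℕ) : ℝ) * (((L : ℝ) ^ j.k)⁻¹ * ((L : ℝ) ^ j.m)⁻¹)
    have hLm : (0 : ℝ) < (L : ℝ) ^ j.m := pow_pos hLr _
    push_cast
    field_simp
  exact ne2PlusOperator_v1GC e (I := VecIndexS d L) (J := Fin (d + 1)) (fun j => unitTorusGeoS L j.k j.Mn j.Msz)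
    (fun j => Tor (fine (L ^ j.k) j.Mn) × Fin (d + 1)) (fun j => Tor (fine (L ^ j.m * L ^ j.k) j.Mn) × Fin (d + 1))
    (fun j => blkFine L j.k j.Mn) (fun j => kingPrV L j.k j.m j.Mn) (fun j κ => bshiftEquiv j.Mn (L ^ j.k) κ) (fun j κ => bshiftEquiv j.Mn (L ^ j.m * L ^ j.k) κ)
    (fun j => j.m) (fun j => L ^ j.m) (fun j => unitTorusGeoS_L_ne_zero L hL j) (thetaV L) (fun j => ((2 * ((d + 1) * (L ^ j.m - 1)) : ℕ) : ℝ))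
    (fun j => Sum.inl j.ν)
    (fun j => tensorId ι (pieceG L j.Mn (L ^ j.k) j.k (rweight (d := d) L j.k)))
    (fun j => tensorId ι (pieceS L j.Mn (L ^ j.k) j.k (rweight (d := d) L j.k) j.ν))
    (fun j => tensorId ι (pieceD3 L j.Mn (L ^ j.k) j.k (rweight (d := d) L j.k)))
    (fun j μ => tensorId ι (dPieces L j.Mn (L ^ j.k) j.k (rweight (d := d) L j.k) μ))
    (fun j μ => tensorId ι (mPieces L j.Mn (L ^ j.k) j.k (rweight (d := d) L j.k) j.ν μ))
    (fun j => tensorId ι (pieceG L j.Mn (L ^ j.m * L ^ j.k) (j.k + j.m) (rweight (d := d) L j.k / ((L : ℝ) ^ j.m) ^ (d + 1))))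
    (fun j => tensorId ι (pieceS L j.Mn (L ^ j.m * L ^ j.k) (j.k + j.m) (rweight (d := d) L j.k / ((L : ℝ) ^ j.m) ^ (d + 1)) j.ν))
    (fun j => tensorId ι (pieceD3 L j.Mn (L ^ j.m * L ^ j.k) (j.k + j.m) (rweight (d := d) L j.k / ((L : ℝ) ^ j.m) ^ (d + 1))))
    (fun j μ => tensorId ι (dPieces L j.Mn (L ^ j.m * L ^ j.k) (j.k + j.m) (rweight (d := d) L j.k / ((L : ℝ) ^ j.m) ^ (d + 1)) μ))
    (fun j μ => tensorId ι (mPieces L j.Mn (L ^ j.m * L ^ j.k) (j.k + j.m) (rweight (d := d) L j.k / ((L : ℝ) ^ j.m) ^ (d + 1)) j.ν μ))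
    c35 hc35 (fun j => triangle254_unitTorusGeo L j.k j.Mn) (fun j a b => tdistT_nonneg _ _ _) hσ.le
    (B4Sect5Proof.latticeConst_nonneg (d + 1) hσ.le) (fun j => rowSum_unitTorusGeo L j.k j.Mn hσ)
    (fun j => inv_pos.mpr (pow_pos hLr _)) (fun j => inv_le_one_of_one_le₀ (one_le_pow₀ hL1)) (fun j => inv_pow_le_rpow hL j.k (by norm_num))
    (fun j => hL1) (fun j y => (unitTorusGeo_len L j.k j.Mn hL0 y).symm.le)
    (by linarith) hβ.le hm₀.le (by norm_num : (0 : ℝ) < 1 / 4) (fun j y => le_rfl)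
    (fun j μ κ x => bshiftEquiv_comm j.Mn (L ^ j.m * L ^ j.k) μ κ x) (fun j => Nat.cast_nonneg _)
    (fun j f b hf => fibre_conn_kingPrV L j.k j.m j.Mn f b hf) hd1 hCθ hblk hN
    (fun j => (H j).1) (fun j => (H j).2.1) (fun j => (H j).2.2.1) (fun j => (H j).2.2.2.1) (fun j => (H j).2.2.2.2.1)
    (fun j => (H j).2.2.2.2.2.1) (fun j => (H j).2.2.2.2.2.2.1) (fun j => (H j).2.2.2.2.2.2.2.1) (fun j => (H j).2.2.2.2.2.2.2.2.1)
    (fun j => (H j).2.2.2.2.2.2.2.2.2.1) (fun j => (H j).2.2.2.2.2.2.2.2.2.2.1) (fun j => (H j).2.2.2.2.2.2.2.2.2.2.2)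


/-- The four-dimensional instance (`d + 1 = 4`). [cite: Balaban1985BackgroundPropagators, Thm 3.1 p.397 (quantifier template)] -/
theorem ne2PlusOperator_vectorPiece_v1GC_dim4 (hL : 1 ≤ L) (c35 : ℝ) (hc35 : 0 < c35) :
    NE2PlusOperator c35 (v1GVecInstance (d := 3) 𝔄 ι L hL) (v1GCVecFamily4 (d := 3) 𝔄 ι e L hL) :=
  ne2PlusOperator_vectorPiece_v1GC (d := 3) e (by norm_num) hL c35 hc35

/-- **NE2⁰ FOR THE SAME FAMILY — `T4EtaRate.NE2ZeroOperator` BY NAME**: the trivial gauge field satisfies the C² letters (g3's `ne2ZeroOperator_vectorPiece_v1G`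
argument verbatim; the instance is unchanged), so `ne2Zero_of_ne2Plus` applies at `c₃₅ = 1`. [cite: King1986, Props. 3.8–3.9 (3.71)–(3.75) pp.664–665 (A = 0 model); Balaban1985BackgroundPropagators, Thm 3.1 p.397 (quantifier template)] -/
theorem ne2ZeroOperator_vectorPiece_v1GC (hd : 1 ≤ d) (hL : 1 ≤ L) :
    NE2ZeroOperator (v1GVecInstance (d := d) 𝔄 ι L hL) (v1GCVecFamily4 (d := d) 𝔄 ι e L hL) := by
  refine ne2Zero_of_ne2Plus (c35 := 1) (fun j α₀ hα₀ => ?_) (ne2PlusOperator_vectorPiece_v1GC (d := d) e hd hL 1 one_pos)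
  have hM : 0 ≤ (1 : ℝ) * j.Msz * α₀ := by
    have h1 : (0 : ℝ) ≤ j.Msz := zero_le_one.trans j.one_le_Msz
    positivity
  have hLr : (0 : ℝ) ≤ (L : ℝ) := Nat.cast_nonneg L
  have hη : 0 ≤ ((L : ℝ) ^ j.k)⁻¹ * ((L : ℝ) ^ j.m)⁻¹ := mul_nonneg (inv_nonneg.2 (pow_nonneg hLr _)) (inv_nonneg.2 (pow_nonneg hLr _))
  refine ⟨fun μ x' => ?_, fun μ κ x' => ?_, fun μ κ x' => ?_⟩
  · show ‖(0 : 𝔄)‖ ≤ 1 * j.Msz * α₀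
    rw [norm_zero]; exact hM
  · show ‖(0 : 𝔄) - 0‖ ≤ 1 * j.Msz * α₀ * (((L : ℝ) ^ j.k)⁻¹ * ((L : ℝ) ^ j.m)⁻¹)
    rw [sub_zero, norm_zero]; exact mul_nonneg hM hη
  · show ‖(0 : 𝔄) - 0 - (0 - 0)‖ ≤ 1 * j.Msz * α₀ * (((L : ℝ) ^ j.k)⁻¹ * ((L : ℝ) ^ j.m)⁻¹) * (((L : ℝ) ^ j.k)⁻¹ * ((L : ℝ) ^ j.m)⁻¹)
    rw [show (0 : 𝔄) - 0 - (0 - 0) = 0 by simp, norm_zero]; exact mul_nonneg (mul_nonneg hM hη) hη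

/-- The four-dimensional instance of the NE2⁰ corollary. [cite: King1986, Props. 3.8–3.9 (3.71)–(3.75) pp.664–665 (A = 0 model)] -/
theorem ne2ZeroOperator_vectorPiece_v1GC_dim4 (hL : 1 ≤ L) :
    NE2ZeroOperator (v1GVecInstance (d := 3) 𝔄 ι L hL) (v1GCVecFamily4 (d := 3) 𝔄 ι e L hL) :=
  ne2ZeroOperator_vectorPiece_v1GC (d := 3) e (by norm_num) hL

end Knit

end Summit.QuantumFields.YangMills.BalabanUVNodes.N15.VectorPiece

end
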